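import Summits.BirchSwinnertonDyer.BirchSwinnertonDyer.Theorems.PrintX9MuPartSpecWitnessDefs
import HarnessLib

/-!
# Specialisation witnesses ALONG AN INFINITE SET OF LEVELS `m`: the predicate `HasSpecWitnessesAlong`
# and the weakened coherent-pair shell `SpecWitnessesCoherentPairAlong` (definitions file)

Cell `pub/bsd-print-x9`, seat `bsd-line-x9-p1-w3` (g3, extra width on line `torsion-depth-pinned`), for the
μ-LEAD lineage `bsd-line-x9-p1` (crux stmt-BirchSwinnertonDyer-27077; skeleton v8: ONE stub = the L∃ letter
`HeegnerMuPartStabilized.MuPartStabilizedCoherentPair`, p630902, via the tree shell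
`HeegnerMuPartStabilized.SpecWitnessesCoherentPair`, p632362). DEFINITIONS WITH BODIES + unfolding /
monotonicity lemmas; NOTHING is asserted, no named fact, no instance, no `sorry`. ROUTE-INDEPENDENT (imports
no `Theses` file). TRANSCRIBED into the importable tree from bsd-idea-16's crux-ideation workfile
`Cruxes/HowardContainmentAnyClassNumberX10b/Lines/specialise_first_mu_x10b.lean` v11 §14 (seat
bsd-idea-16 g5, card `specialise-first-mu-x10b` v11; Cruxes workfiles cannot be imported by `Theorems` files),
statements VERBATIM up to the namespace; design credit: bsd-idea-16.

WHY. The μ-readout of the specialised road (`IwasawaAlgebra.lengthAt_le_two_mul_of_card_quotSMulTop_qm_le`,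
x10b-p1 p625052) is stated for the specialised inequality at ALL large `m`; but the `q_m`-asymptotics
`IwasawaAlgebra.exists_card_quotSMulTop_qm_bounds` are TWO-SIDED (`#(N/q_m N) ≍ p^(m·μ(N))`), so the
inequality along ANY infinite set of levels `m` already forces `μ(𝒳_tors) ≤ 2·μ(𝔖/L)` (sibling proofs file
`PrintX9MuPartStabilizedOfSpecWitnessesAlong`). Hence the D1 constructor of the shared μ-item may CHOOSE its
levels: e.g. insist on `p^t ∣ m` (where `(1+T)^(p^t) - 1 ∈ (p, T^(p^t))` makes the level-`t` twist uniformly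
small, `IwasawaAlgebraEisensteinSpecializationUnitProofs`), or discard any finite or density-zero set of bad `m`.

WHAT.
* `HasSpecWitnessesAlong p S X L : Prop` — «∃ c, for infinitely many `m`, a `SpecWitness` (p632362) at
  `q_m = T^m + p` with constant `p^c`»; weaker than `HasSpecWitnesses` (all large `m`):
  `hasSpecWitnessesAlong_of_hasSpecWitnesses`.
* `SpecWitnessesCoherentPairAlong : Prop` — the tree L∃ shell `SpecWitnessesCoherentPair` with
  `HasSpecWitnesses` replaced by `HasSpecWitnessesAlong`; a SECOND, WEAKER admissible target for the D1 seat: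
  `specWitnessesCoherentPairAlong_of_specWitnessesCoherentPair` (here), and it still gives the installed letter
  `MuPartStabilizedCoherentPair` and crux 27077 BY NAME (sibling proofs files).
«beyond-print theorem»: no (nothing is proved here beyond two one-line monotonicity lemmas). BSD is NOT proved
by this file; no summit statement is proved by this seat.

References: [Howard2004HeegnerKolyvagin] Compositio Math. 140 (2004), proof of Thm. 2.2.10 (the height-one
prime `pΛ` via `𝔮 = T^m + p`, `m → ∞`); [MastellaZerman2026] arXiv:2505.08710, Thm. 2.40 (shape of the witness
fields); [Washington1997] §13.2 (μ from specialised cardinalities); crux card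
`Cruxes/HowardContainmentAnyClassNumberX10b/Lines/specialise-first-mu-x10b.md` v11 §14.
-/

set_option linter.dupNamespace false
set_option autoImplicit false

noncomputable section

open scoped Classical Pointwise
open Literature Literature.NumberTheory.EllipticCurves WeierstrassCurve

namespace Summit.BirchSwinnertonDyer.BirchSwinnertonDyer.Theorems.HeegnerMuPartStabilized

universe v w

/-! ## The pointwise predicate along an infinite set of levels -/

/-- **`HasSpecWitnessesAlong p S X L`** (pointwise, frame-free, module-level): there is a constant `c` such
that for INFINITELY MANY levels `m` (spelled `∀ M, ∃ m ≥ M`) a `SpecWitness` at Howard's Eisenstein prime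
`q_m = T^m + p` with control constant `p^c` exists. Weaker than `HasSpecWitnesses` (witnesses at all large
`m`). A statement abbreviation (NOT asserted, NOT a named fact, no citation tag: it is the cell's beyond-print
residual in witness form, cf. Howard 2004, proof of Thm. 2.2.10 at `𝔮 = T^m + p`, for the device of letting
`m → ∞` along a sequence of Eisenstein primes). -/
abbrev HasSpecWitnessesAlong (p : ℕ) [Fact p.Prime] (S : Type v) (X : Type w) [AddCommGroup S]
    [Module (IwasawaAlgebra p) S] [AddCommGroup X] [Module (IwasawaAlgebra p) X]
    (L : Submodule (IwasawaAlgebra p) S) : Prop :=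
  ∃ c : ℕ, ∀ M : ℕ, ∃ m : ℕ, M ≤ m ∧
    Nonempty (SpecWitness (IwasawaAlgebra p) S X L
      (PowerSeries.X ^ m + PowerSeries.C (p : ℤ_[p]) : IwasawaAlgebra p) (p ^ c))

/-- Unfolding lemma (`Iff.rfl`). [folklore] -/
theorem hasSpecWitnessesAlong_iff (p : ℕ) [Fact p.Prime] (S : Type v) (X : Type w) [AddCommGroup S]
    [Module (IwasawaAlgebra p) S] [AddCommGroup X] [Module (IwasawaAlgebra p) X]
    (L : Submodule (IwasawaAlgebra p) S) :
    HasSpecWitnessesAlong p S X L ↔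
      ∃ c : ℕ, ∀ M : ℕ, ∃ m : ℕ, M ≤ m ∧
        Nonempty (SpecWitness (IwasawaAlgebra p) S X L
          (PowerSeries.X ^ m + PowerSeries.C (p : ℤ_[p]) : IwasawaAlgebra p) (p ^ c)) :=
  Iff.rfl

/-- `HasSpecWitnesses` (witnesses at all large `m`) ⟹ `HasSpecWitnessesAlong` (witnesses at infinitely many
`m`): take `m := max M m₀`. [folklore] -/
theorem hasSpecWitnessesAlong_of_hasSpecWitnesses (p : ℕ) [Fact p.Prime] {S : Type v} {X : Type w}
    [AddCommGroup S] [Module (IwasawaAlgebra p) S] [AddCommGroup X] [Module (IwasawaAlgebra p) X]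
    {L : Submodule (IwasawaAlgebra p) S} (h : HasSpecWitnesses p S X L) :
    HasSpecWitnessesAlong p S X L := by
  obtain ⟨c, m₀, hw⟩ := h
  exact ⟨c, fun M => ⟨max M m₀, le_max_left _ _, hw _ (le_max_right _ _)⟩⟩

/-! ## The weakened coherent-pair shell -/

/-- **L∃ shell ALONG AN INFINITE SET OF LEVELS** — the tree shell `SpecWitnessesCoherentPair` (p632362: the
prefix of the L∃ letter `MuPartStabilizedCoherentPair`, p630902, + `p ∤ N` + the engine's two tower inputs; for
every `(Dt, β, D, X)` an exported stabilised datum `C` and Howard family `F` on `(Dt, β)` with both envelopes)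
with the conclusion `HasSpecWitnesses p 𝔖 𝒳 Λκ_∞(C)` REPLACED by `HasSpecWitnessesAlong p 𝔖 𝒳 Λκ_∞(C)`
(witnesses at infinitely many `q_m` only). A second admissible target for the D1 constructor: implied by the
tree shell (`specWitnessesCoherentPairAlong_of_specWitnessesCoherentPair`) and still sufficient for the letter
and the crux by name (sibling proofs files). A statement abbreviation; NOT asserted, NOT a named fact, no
citation tag (beyond-print residual of the cell, not a published result). -/
abbrev SpecWitnessesCoherentPairAlong : Prop :=
  ∀ (N : ℕ) [NeZero N] (W : WeierstrassCurve ℚ) [W.IsGloballyMinimal] (K : Type) [Field K] [NumberField K]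
    (p : ℕ) [Fact p.Prime] (κ : ZpExtension K p) (γ : Field.absoluteGaloisGroup K)
    (jbar : AlgebraicClosure K →+* ℂ),
    CastellaGrossiLeeSkinner2022.Thm413Hypotheses N W K p κ γ →
    ¬ W.HasCM → W.HasIrreducibleModPGaloisRep p → (W.baseChange K).HasIrreducibleModPGaloisRep p →
    MastellaZerman2026.HasPadicScalarImage W p → SatisfiesHeegnerHypothesis p K →
    p ∣ NumberField.classNumber K →
    ¬ p ∣ N →
    (∀ k, ringClassSubgroup K (p ^ (k + 1)) jbar ≤ κ.layerSubgroup k) →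
    Nat.card (ringClassGalOver (jbar.comp (algebraMap K (AlgebraicClosure K))) p 1) = p - 1 →
    ∀ (Dt : ModularForms.ModularParametrizationData W N) (β : ℤ), (4 * N : ℤ) ∣ β ^ 2 - NumberField.discr K →
    ∀ (D : (W.baseChange K).LambdaAdicSelmerData κ γ) (X : (W.baseChange K).SelmerDualData κ γ),
    ∃ (C : CastellaGrossiLeeSkinner2022.StabilizedHeegnerData N W K κ jbar) (F : HeegnerFamily N W K κ jbar),
      C.Dt = Dt ∧ F.Dt = Dt ∧ C.β = β ∧ F.β = β ∧
      heegnerModule D F ≤ CastellaGrossiLeeSkinner2022.stabilizedHeegnerModule D C ∧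
      (∃ g : IwasawaAlgebra p, g ≠ 0 ∧
        g • CastellaGrossiLeeSkinner2022.stabilizedHeegnerModule D C ≤ heegnerModule D F) ∧
      (Module.Finite (IwasawaAlgebra p) D.S → Module.Finite (IwasawaAlgebra p) X.X →
        Module.IsTorsion (IwasawaAlgebra p)
          (D.S ⧸ CastellaGrossiLeeSkinner2022.stabilizedHeegnerModule D C) →
        HasSpecWitnessesAlong p D.S X.X (CastellaGrossiLeeSkinner2022.stabilizedHeegnerModule D C))

/-- **The tree L∃ shell ⟹ the shell along an infinite set of levels** (the «along» shell is the WEAKER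
statement): same exported pair, `hasSpecWitnessesAlong_of_hasSpecWitnesses` on the last conjunct. [folklore] -/
theorem specWitnessesCoherentPairAlong_of_specWitnessesCoherentPair (h : SpecWitnessesCoherentPair) :
    SpecWitnessesCoherentPairAlong := by
  intro N _ W _ K _ _ p _ κ γ jbar hyp hcm hirr hirrK hsc hHp hhK hpN hTw1 hcardp Dt β hβ D X
  obtain ⟨C, F, hCDt, hFDt, hCβ, hFβ, hfwd, hrev, hWit⟩ :=
    h N W K p κ γ jbar hyp hcm hirr hirrK hsc hHp hhK hpN hTw1 hcardp Dt β hβ D X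
  exact ⟨C, F, hCDt, hFDt, hCβ, hFβ, hfwd, hrev, fun hfinS hfinX htorC =>
    hasSpecWitnessesAlong_of_hasSpecWitnesses p (hWit hfinS hfinX htorC)⟩

end Summit.BirchSwinnertonDyer.BirchSwinnertonDyer.Theorems.HeegnerMuPartStabilized

end
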